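import Mathlib.Analysis.SpecificLimits.Basic
import Mathlib.Data.Nat.Factorial.DoubleFactorial
import Mathlib.Data.Nat.Factorial.BigOperators
import Mathlib.Data.Nat.Choose.Basic
import Literature.Computability.Complexity.BonamiLevelK
import HarnessLib

/-!
# Even moments of Rademacher sums: sharp Khintchine bounds and the moment central limit theorem

For the Rademacher sum `S_k(x) = ∑_{j<k} (-1)^{x_j}` on the uniform cube `{0,1}^k` (conventions of
`Literature/Computability/Complexity/BooleanFourier.lean`: `sgn`, averages `(∑_x ·)/2^k`) we prove

* `radMoment_succ_even` — the **moment recursion** `𝔼 S_{k+1}^{2s} = ∑_{i ≤ s} C(2s,2i) 𝔼 S_k^{2s-2i}`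
  (split off one sign, `((a+1)^{2s} + (a-1)^{2s})/2 = ∑_i C(2s,2i) a^{2s-2i}`);
* `radMoment_odd` — odd moments vanish (global sign flip);
* `radMoment_even_le` — the **sharp even-moment Khintchine inequality**
  `𝔼 S_k^{2s} ≤ (2s-1)‼ k^s = 𝔼 (√k Z)^{2s}` (`Z` standard Gaussian): Rademacher sums have smaller
  even moments than the Gaussian of the same variance (coefficientwise,
  `C(2s,2i) (2s-2i-1)‼ ≤ (2s-1)‼ C(s,i)`, i.e. `(2i-1)‼ ≥ 1` in the Gaussian addition law
  `C(2s,2i)(2i-1)‼(2s-2i-1)‼ = (2s-1)‼ C(s,i)`);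
* `radMoment_even_ge` — the matching **lower bound** `𝔼 S_k^{2s} ≥ (2s-1)‼ k(k-1)⋯(k-s+1)`
  (perfect matchings with distinct labels; proved from the recursion via
  `(k+1)^{(s)} = k^{(s)} + s k^{(s-1)}`);
* `tendsto_radMomentN_even`, `radMomentN_odd`, `tendsto_radMomentN` — the **moment central limit theorem for
  Rademacher sums**: `𝔼 (S_k/√k)^{2s} → (2s-1)‼` and `𝔼 (S_k/√k)^{2s+1} = 0`, i.e. all moments of
  `S_k/√k` converge to those of the standard Gaussian (`gaussMoment q = (q-1)‼` for even `q`, `0`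
  for odd `q`; the identification with `∫ x^q d𝒩(0,1)` is
  `Literature.Probability.Distributions.integral_pow_even_gaussianReal_one` /
  `integral_pow_odd_gaussianReal`).

This is the input of the classical transfer of Bonami's hypercontractive inequality from the cube
to Gaussian space (Gross 1975, §4; Janson 1997, Thm. 5.8 ff.; file
`GaussianHypercontractivity.lean`). Everything is a finite sum; no named facts.

## References

* A. Khintchine, *Über dyadische Brüche*, Math. Z. 18 (1923) 109–116; U. Haagerup, *The best
  constants in the Khintchine inequality*, Studia Math. 70 (1981) 231–283 (sharp even-moment
  constant `(2s-1)‼`, attained in the Gaussian limit). [Haagerup1981]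
* L. Gross, *Logarithmic Sobolev inequalities*, Amer. J. Math. 97 (1975) 1061–1083, §4 (two-point
  space ⇒ Gauss space by the central limit theorem). [Gross1975]
* S. Janson, *Gaussian Hilbert Spaces*, Cambridge Tracts in Math. 129 (1997), Rem. 1.30
  (`E ξ^{2s} = (2s-1)‼`), Ch. 5. [Janson1997]
* R. O'Donnell, *Analysis of Boolean Functions*, CUP 2014, §9.1 (the two-point step), §11.1
  (Gaussian space as a limit of the cube). [ODonnell2014]
* A. Bonami, *Étude des coefficients de Fourier des fonctions de `L^p(G)`*, Ann. Inst. Fourier 20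
  (1970) 335–402. [Bonami1970]
-/

noncomputable section

namespace Literature.Probability.Distributions

open Finset Filter Topology
open Literature.Probability.RandomGraphs.LowDegree Literature.Computability.Complexity.LowDegree
open scoped Nat

/-! ### Rademacher sums and their moments -/

/-- The Rademacher sum `S_k(x) = ∑_{j<k} (-1)^{x_j}` on the cube `{0,1}^k`. [folklore] -/
def radSum (k : ℕ) (x : Fin k → Bool) : ℝ := ∑ j, sgn (x j)

/-- The `q`-th moment `𝔼 S_k^q = 2^{-k} ∑_x S_k(x)^q` of the Rademacher sum under the uniform
measure. [folklore] -/
def radMoment (k q : ℕ) : ℝ := (∑ x : Fin k → Bool, radSum k x ^ q) / 2 ^ k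

/-- The normalised moment `𝔼 (S_k/√k)^q`. [folklore] -/
def radMomentN (k q : ℕ) : ℝ := (∑ x : Fin k → Bool, (radSum k x / Real.sqrt k) ^ q) / 2 ^ k

/-- The moments of the standard Gaussian as a sequence: `(q-1)‼` for even `q`, `0` for odd `q`.
[cite: Janson1997, Rem. 1.30] -/
def gaussMoment (q : ℕ) : ℝ := if Even q then ((q - 1)‼ : ℝ) else 0

/-- `gaussMoment (2s) = (2s-1)‼`. [folklore] -/
theorem gaussMoment_even (s : ℕ) : gaussMoment (2 * s) = ((2 * s - 1)‼ : ℝ) := by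
  simp [gaussMoment]

/-- `gaussMoment (2s+1) = 0`. [folklore] -/
theorem gaussMoment_odd (s : ℕ) : gaussMoment (2 * s + 1) = 0 := by
  simp [gaussMoment]

/-- The empty Rademacher sum is `0`. [folklore] -/
@[simp] theorem radSum_zero (x : Fin 0 → Bool) : radSum 0 x = 0 := by
  simp [radSum]

/-- Splitting off the first sign: `S_{k+1}(b, y) = (-1)^b + S_k(y)`. [folklore] -/
theorem radSum_cons (k : ℕ) (b : Bool) (y : Fin k → Bool) :
    radSum (k + 1) (Fin.cons b y) = sgn b + radSum k y := by
  simp [radSum, Fin.sum_univ_succ]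

/-- `|S_k(x)| ≤ k`. [folklore] -/
theorem abs_radSum_le (k : ℕ) (x : Fin k → Bool) : |radSum k x| ≤ k := by
  unfold radSum
  refine (abs_sum_le_sum_abs _ _).trans ?_
  have : ∀ j ∈ (univ : Finset (Fin k)), |sgn (x j)| ≤ 1 := fun j _ => by
    cases x j <;> simp [sgn]
  refine (sum_le_sum this).trans ?_
  simp

/-- Moments at `k = 0`: `𝔼 S_0^q = 0^q`. [folklore] -/
theorem radMoment_zero_left (q : ℕ) : radMoment 0 q = (0 : ℝ) ^ q := by
  simp [radMoment]

/-- `𝔼 S_k^0 = 1`. [folklore] -/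
theorem radMoment_zero_right (k : ℕ) : radMoment k 0 = 1 := by
  simp [radMoment]

/-- Moments are averages of nonnegative quantities for even exponents: `0 ≤ 𝔼 S_k^{2s}`. [folklore] -/
theorem radMoment_even_nonneg (k s : ℕ) : 0 ≤ radMoment k (2 * s) := by
  unfold radMoment
  refine div_nonneg (sum_nonneg fun x _ => ?_) (by positivity)
  rw [pow_mul]; positivity

/-- **The moment recursion**: `𝔼 S_{k+1}^{2s} = ∑_{i ≤ s} C(2s, 2i) 𝔼 S_k^{2(s-i)}`. [cite: ODonnell2014, §9.1] -/
theorem radMoment_succ_even (k s : ℕ) :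
    radMoment (k + 1) (2 * s) =
      ∑ i ∈ range (s + 1), ((2 * s).choose (2 * i) : ℝ) * radMoment k (2 * (s - i)) := by
  unfold radMoment
  rw [sum_cube_succ]
  have key : ∀ y : Fin k → Bool,
      radSum (k + 1) (Fin.cons false y) ^ (2 * s) + radSum (k + 1) (Fin.cons true y) ^ (2 * s) =
        2 * ∑ i ∈ range (s + 1), ((2 * s).choose (2 * i) : ℝ) * radSum k y ^ (2 * (s - i)) := by
    intro y
    rw [radSum_cons, radSum_cons, sgn_false, sgn_true]
    have h := two_point_expand (radSum k y) 1 s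
    rw [show (1 : ℝ) + radSum k y = radSum k y + 1 by ring,
      show (-1 : ℝ) + radSum k y = radSum k y - 1 by ring]
    rw [div_eq_iff (two_ne_zero)] at h
    rw [h, mul_comm]
    congr 1
    refine sum_congr rfl fun i _ => ?_
    rw [one_pow, one_pow, mul_one, ← pow_mul]
  simp_rw [key]
  rw [← mul_sum, pow_succ, mul_comm ((2 : ℝ) ^ k) 2, mul_div_mul_left _ _ (two_ne_zero' ℝ), sum_comm,
    sum_div]
  refine sum_congr rfl fun i _ => ?_
  rw [← mul_sum, mul_div_assoc]

/-- **Odd moments vanish**: `𝔼 S_k^{2s+1} = 0` (the sign flip `x ↦ ¬x` negates `S_k`). [folklore] -/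
theorem radMoment_odd (k s : ℕ) : radMoment k (2 * s + 1) = 0 := by
  unfold radMoment
  have hflip : ∀ x : Fin k → Bool, radSum k (fun j => !x j) = -radSum k x := by
    intro x
    simp only [radSum, ← sum_neg_distrib]
    refine sum_congr rfl fun j _ => ?_
    cases x j <;> simp [sgn]
  set e : (Fin k → Bool) ≃ (Fin k → Bool) :=
    { toFun := fun x j => !x j, invFun := fun x j => !x j,
      left_inv := fun x => by funext j; simp, right_inv := fun x => by funext j; simp } with he
  have hsum : ∑ x : Fin k → Bool, radSum k x ^ (2 * s + 1) = ∑ x : Fin k → Bool, radSum k (e x) ^ (2 * s + 1) :=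
    (Fintype.sum_equiv e _ _ fun x => rfl).symm
  have hneg : ∑ x : Fin k → Bool, radSum k (e x) ^ (2 * s + 1) = -∑ x : Fin k → Bool, radSum k x ^ (2 * s + 1) := by
    rw [← sum_neg_distrib]
    refine sum_congr rfl fun x _ => ?_
    show radSum k (fun j => !x j) ^ (2 * s + 1) = _
    rw [hflip, Odd.neg_pow ⟨s, rfl⟩]
  have h0 : ∑ x : Fin k → Bool, radSum k x ^ (2 * s + 1) = 0 := by linarith [hsum.trans hneg]
  rw [h0, zero_div]

/-! ### Double factorial arithmetic -/

/-- **The Gaussian addition law, coefficientwise**: `C(2s,2i) (2i-1)‼ (2(s-i)-1)‼ = (2s-1)‼ C(s,i)`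
for `i ≤ s` (both sides count the perfect matchings of `2s` points refined by how many pairs fall in a
fixed `2i`-subset pattern; equivalently `𝔼(X+Y)^{2s}` for independent Gaussians). [folklore] -/
theorem choose_two_mul_mul_doubleFactorial (s i : ℕ) (hi : i ≤ s) :
    (2 * s).choose (2 * i) * (2 * i - 1)‼ * (2 * (s - i) - 1)‼ = (2 * s - 1)‼ * s.choose i := by
  -- `(2n)! = 2^n n! (2n-1)‼` (also `Literature.Probability.LatticeModels.factorial_two_mul_eq`,
  -- kept local to avoid importing the planar-Ising files into this elementary one)
  have hfact : ∀ n : ℕ, (2 * n)! = 2 ^ n * n ! * (2 * n - 1)‼ := by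
    intro n
    rcases n with _ | n
    · simp
    · have h1 : (2 * (n + 1))! = (2 * (n + 1))‼ * (2 * n + 1)‼ := by
        rw [show 2 * (n + 1) = (2 * n + 1) + 1 by ring]
        exact Nat.factorial_eq_mul_doubleFactorial _
      rw [h1, Nat.doubleFactorial_two_mul, show 2 * (n + 1) - 1 = 2 * n + 1 by omega]
  have h1 := Nat.choose_mul_factorial_mul_factorial (show 2 * i ≤ 2 * s by omega)
  have h2 := Nat.choose_mul_factorial_mul_factorial hi
  rw [show 2 * s - 2 * i = 2 * (s - i) by omega] at h1
  rw [hfact i, hfact (s - i), hfact s] at h1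
  -- cancel the common positive factor `2^s · i! · (s-i)!`
  have hpos : 0 < 2 ^ s * i ! * (s - i)! := by positivity
  refine Nat.eq_of_mul_eq_mul_right hpos ?_
  have h2' : s ! = s.choose i * i ! * (s - i)! := h2.symm
  have hpow : 2 ^ s = 2 ^ i * 2 ^ (s - i) := by rw [← pow_add]; congr 1; omega
  calc (2 * s).choose (2 * i) * (2 * i - 1)‼ * (2 * (s - i) - 1)‼ * (2 ^ s * i ! * (s - i)!)
      = (2 * s).choose (2 * i) * (2 ^ i * i ! * (2 * i - 1)‼) * (2 ^ (s - i) * (s - i)! * (2 * (s - i) - 1)‼) := by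
        rw [hpow]; ring
    _ = 2 ^ s * s ! * (2 * s - 1)‼ := h1
    _ = (2 * s - 1)‼ * s.choose i * (2 ^ s * i ! * (s - i)!) := by rw [h2']; ring

/-- The coefficient inequality of the sharp Khintchine bound:
`C(2s,2i) (2(s-i)-1)‼ ≤ (2s-1)‼ C(s,i)`. [cite: Haagerup1981] -/
theorem choose_two_mul_mul_doubleFactorial_le (s i : ℕ) (hi : i ≤ s) :
    ((2 * s).choose (2 * i) : ℝ) * ((2 * (s - i) - 1)‼ : ℝ) ≤ ((2 * s - 1)‼ : ℝ) * (s.choose i : ℝ) := by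
  have h := choose_two_mul_mul_doubleFactorial s i hi
  have h1 : (1 : ℝ) ≤ ((2 * i - 1)‼ : ℝ) := by exact_mod_cast Nat.doubleFactorial_pos _
  have hcast : ((2 * s).choose (2 * i) : ℝ) * ((2 * i - 1)‼ : ℝ) * ((2 * (s - i) - 1)‼ : ℝ) =
      ((2 * s - 1)‼ : ℝ) * (s.choose i : ℝ) := by exact_mod_cast h
  have hnn : 0 ≤ ((2 * s).choose (2 * i) : ℝ) * ((2 * (s - i) - 1)‼ : ℝ) := by positivity
  nlinarith

/-- `C(2(s+1), 2) = (s+1)(2s+1)`. [folklore] -/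
theorem choose_two_mul_succ_two (s : ℕ) : (2 * (s + 1)).choose 2 = (s + 1) * (2 * s + 1) := by
  rw [Nat.choose_two_right]
  rw [show 2 * (s + 1) * (2 * (s + 1) - 1) = (s + 1) * (2 * s + 1) * 2 by
    rw [show 2 * (s + 1) - 1 = 2 * s + 1 by omega]; ring]
  simp

/-- **Pascal's rule for falling factorials**: `(k+1)^{(s+1)} = k^{(s+1)} + (s+1) k^{(s)}`. [folklore] -/
theorem succ_descFactorial_succ_eq_add (k s : ℕ) :
    (k + 1).descFactorial (s + 1) = k.descFactorial (s + 1) + (s + 1) * k.descFactorial s := by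
  rw [Nat.succ_descFactorial_succ, Nat.descFactorial_succ]
  rcases Nat.lt_or_ge k s with h | h
  · rw [Nat.descFactorial_eq_zero_iff_lt.2 h]; simp
  · have : (k - s) * k.descFactorial s + (s + 1) * k.descFactorial s = (k - s + (s + 1)) * k.descFactorial s := by ring
    rw [this]; congr 1; omega

/-! ### The sharp two-sided even-moment bounds -/

/-- **Sharp even-moment Khintchine inequality**: `𝔼 S_k^{2s} ≤ (2s-1)‼ k^s`. [cite: Haagerup1981] -/
theorem radMoment_even_le : ∀ (k s : ℕ), radMoment k (2 * s) ≤ ((2 * s - 1)‼ : ℝ) * (k : ℝ) ^ s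
  | 0, s => by
    rw [radMoment_zero_left]
    rcases s with _ | s
    · simp
    · rw [zero_pow (by omega), Nat.cast_zero, zero_pow (by omega), mul_zero]
  | k + 1, s => by
    rw [radMoment_succ_even]
    calc ∑ i ∈ range (s + 1), ((2 * s).choose (2 * i) : ℝ) * radMoment k (2 * (s - i))
        ≤ ∑ i ∈ range (s + 1), ((2 * s).choose (2 * i) : ℝ) * (((2 * (s - i) - 1)‼ : ℝ) * (k : ℝ) ^ (s - i)) :=
          sum_le_sum fun i _ => mul_le_mul_of_nonneg_left (radMoment_even_le k (s - i)) (by positivity)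
      _ ≤ ∑ i ∈ range (s + 1), ((2 * s - 1)‼ : ℝ) * ((s.choose i : ℝ) * (k : ℝ) ^ (s - i)) := by
          refine sum_le_sum fun i hi => ?_
          have hi' : i ≤ s := Nat.lt_succ_iff.1 (mem_range.1 hi)
          have := choose_two_mul_mul_doubleFactorial_le s i hi'
          have hk : 0 ≤ (k : ℝ) ^ (s - i) := by positivity
          nlinarith
      _ = ((2 * s - 1)‼ : ℝ) * ((k : ℝ) + 1) ^ s := by
          rw [← mul_sum, show ((k : ℝ) + 1) = 1 + k by ring, add_pow]
          congr 1
          refine sum_congr rfl fun i _ => ?_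
          rw [one_pow, one_mul, mul_comm]
      _ = ((2 * s - 1)‼ : ℝ) * ((k + 1 : ℕ) : ℝ) ^ s := by push_cast; ring

/-- **Lower bound**: `𝔼 S_k^{2s} ≥ (2s-1)‼ k^{(s)}` with the falling factorial
`k^{(s)} = k(k-1)⋯(k-s+1)`. [folklore] -/
theorem radMoment_even_ge : ∀ (k s : ℕ), ((2 * s - 1)‼ : ℝ) * (k.descFactorial s : ℝ) ≤ radMoment k (2 * s)
  | 0, s => by
    rw [radMoment_zero_left]
    rcases s with _ | s
    · simp
    · rw [(Nat.descFactorial_eq_zero_iff_lt).2 (by omega), Nat.cast_zero, mul_zero,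
        zero_pow (by omega)]
  | k + 1, 0 => by simp [radMoment_zero_right]
  | k + 1, s + 1 => by
    rw [radMoment_succ_even]
    -- keep only the terms `i = 0` and `i = 1`
    have hsplit : ∑ i ∈ range (s + 1 + 1), ((2 * (s + 1)).choose (2 * i) : ℝ) * radMoment k (2 * (s + 1 - i)) =
        radMoment k (2 * (s + 1)) + ((2 * (s + 1)).choose 2 : ℝ) * radMoment k (2 * s) +
          ∑ i ∈ range s, ((2 * (s + 1)).choose (2 * (i + 2)) : ℝ) * radMoment k (2 * (s + 1 - (i + 2))) := by
      rw [sum_range_succ', sum_range_succ']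
      simp only [mul_zero, Nat.choose_zero_right, Nat.cast_one, one_mul, Nat.sub_zero,
        show s + 1 - 1 = s from rfl]
      ring
    have hrest : 0 ≤ ∑ i ∈ range s, ((2 * (s + 1)).choose (2 * (i + 2)) : ℝ) * radMoment k (2 * (s + 1 - (i + 2))) :=
      sum_nonneg fun i _ => mul_nonneg (by positivity) (radMoment_even_nonneg _ _)
    have ih1 := radMoment_even_ge k (s + 1)
    have ih2 := radMoment_even_ge k s
    have hc : ((2 * (s + 1)).choose 2 : ℝ) = (s + 1) * (2 * s + 1) := by
      exact_mod_cast choose_two_mul_succ_two s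
    have hdf : ((2 * (s + 1) - 1)‼ : ℝ) = (2 * s + 1) * ((2 * s - 1)‼ : ℝ) := by
      rw [show 2 * (s + 1) - 1 = 2 * s + 1 by omega]
      exact_mod_cast Nat.doubleFactorial_add_one (2 * s)
    have hdesc : ((k + 1).descFactorial (s + 1) : ℝ) = (k.descFactorial (s + 1) : ℝ) + (s + 1) * (k.descFactorial s : ℝ) := by
      exact_mod_cast succ_descFactorial_succ_eq_add k s
    rw [hsplit, hdesc, hc]
    rw [hdf] at ih1 ⊢
    have h2 : ((s : ℝ) + 1) * (2 * s + 1) * (((2 * s - 1)‼ : ℝ) * (k.descFactorial s : ℝ)) ≤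
        ((s : ℝ) + 1) * (2 * s + 1) * radMoment k (2 * s) :=
      mul_le_mul_of_nonneg_left ih2 (by positivity)
    nlinarith [ih1, h2, hrest]

/-! ### The moment central limit theorem for Rademacher sums -/

/-- Normalised vs. raw moments: `𝔼 (S_k/√k)^q = 𝔼 S_k^q / (√k)^q`. [folklore] -/
theorem radMomentN_eq (k q : ℕ) : radMomentN k q = radMoment k q / (Real.sqrt k) ^ q := by
  unfold radMomentN radMoment
  simp_rw [div_pow]
  rw [← sum_div, div_div, div_div, mul_comm]

/-- For even exponents, `𝔼 (S_k/√k)^{2s} = 𝔼 S_k^{2s} / k^s`. [folklore] -/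
theorem radMomentN_even_eq (k s : ℕ) : radMomentN k (2 * s) = radMoment k (2 * s) / (k : ℝ) ^ s := by
  rw [radMomentN_eq, pow_mul, Real.sq_sqrt (Nat.cast_nonneg k)]

/-- **Odd normalised moments vanish.** [folklore] -/
theorem radMomentN_odd (k s : ℕ) : radMomentN k (2 * s + 1) = 0 := by
  rw [radMomentN_eq, radMoment_odd, zero_div]

/-- **Moment CLT, even case**: `𝔼 (S_k/√k)^{2s} → (2s-1)‼`. [cite: Gross1975, §4] [cite: Janson1997, Rem. 1.30] -/
theorem tendsto_radMomentN_even (s : ℕ) :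
    Tendsto (fun k : ℕ => radMomentN k (2 * s)) atTop (𝓝 ((2 * s - 1)‼ : ℝ)) := by
  -- `k^{(s)}/k^s → 1` (also `Literature.Analysis.Complex.PolyaSchur.tendsto_descFactorial_div_pow`,
  -- kept local to avoid importing the Jensen-polynomial files into this elementary one)
  have hdesc : Tendsto (fun k : ℕ => (k.descFactorial s : ℝ) / (k : ℝ) ^ s) atTop (𝓝 1) := by
    have hev : (fun k : ℕ => ∏ i ∈ range s, (1 - (i : ℝ) / k)) =ᶠ[atTop]
        fun k : ℕ => (k.descFactorial s : ℝ) / (k : ℝ) ^ s := by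
      filter_upwards [eventually_ge_atTop (s + 1)] with k hk
      have hk0 : (k : ℝ) ≠ 0 := by exact_mod_cast (show k ≠ 0 by omega)
      rw [Nat.descFactorial_eq_prod_range, Nat.cast_prod,
        show ((k : ℝ)) ^ s = ∏ _i ∈ range s, (k : ℝ) by rw [prod_const, card_range], ← prod_div_distrib]
      refine prod_congr rfl fun i hi => ?_
      have his : i ≤ k := by have := mem_range.1 hi; omega
      rw [Nat.cast_sub his]
      field_simp
    have hlim : Tendsto (fun k : ℕ => ∏ i ∈ range s, (1 - (i : ℝ) / k)) atTop
        (𝓝 (∏ _i ∈ range s, (1 - 0 : ℝ))) := by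
      refine tendsto_finsetProd _ fun i _ => ?_
      exact tendsto_const_nhds.sub (tendsto_const_div_atTop_nhds_zero_nat (i : ℝ))
    simp only [sub_zero, prod_const_one] at hlim
    exact hlim.congr' hev
  -- squeeze between `(2s-1)‼ k^{(s)}/k^s` and `(2s-1)‼`
  have hlow : Tendsto (fun k : ℕ => ((2 * s - 1)‼ : ℝ) * ((k.descFactorial s : ℝ) / (k : ℝ) ^ s)) atTop
      (𝓝 ((2 * s - 1)‼ : ℝ)) := by
    simpa using hdesc.const_mul ((2 * s - 1)‼ : ℝ)
  refine tendsto_of_tendsto_of_tendsto_of_le_of_le' hlow tendsto_const_nhds ?_ ?_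
  · filter_upwards [eventually_ge_atTop 1] with k hk
    have hkpos : 0 < (k : ℝ) ^ s := by positivity
    rw [radMomentN_even_eq, mul_div_assoc', div_le_div_iff_of_pos_right hkpos]
    exact radMoment_even_ge k s
  · filter_upwards [eventually_ge_atTop 1] with k hk
    have hkpos : 0 < (k : ℝ) ^ s := by positivity
    rw [radMomentN_even_eq, div_le_iff₀ hkpos]
    exact radMoment_even_le k s

/-- **Moment CLT for Rademacher sums**: every moment of `S_k/√k` converges to the corresponding
moment of the standard Gaussian, `𝔼 (S_k/√k)^q → gaussMoment q`. [cite: Gross1975, §4] [cite: Janson1997, Rem. 1.30] -/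
theorem tendsto_radMomentN (q : ℕ) :
    Tendsto (fun k : ℕ => radMomentN k q) atTop (𝓝 (gaussMoment q)) := by
  rcases Nat.even_or_odd q with ⟨s, rfl⟩ | ⟨s, rfl⟩
  · rw [← two_mul, gaussMoment_even]
    exact tendsto_radMomentN_even s
  · rw [gaussMoment_odd]
    simp_rw [radMomentN_odd]
    exact tendsto_const_nhds

end Literature.Probability.Distributions

end
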